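import Summits.BirchSwinnertonDyer.BirchSwinnertonDyer.Theorems.ErratumRoadFiveEulerHalfNotRamE0PrimeReceptacle
import HarnessLib

/-!
# Route `ErratumRoadFive` (K2, `p ≥ 5`), crux `EulerHalfNotRamNoInertSetAtFive` (item stmt-BirchSwinnertonDyer-19715), line `birth` v13:
# the two single-datum producers `hSel` ∕ `hstrq` from a label typed DIRECTLY IN RECEPTACLE CURRENCY at the split carriers
# («`∃ n'` coprime to `p`, `n' • (e (γ • y_m))_v ∈ E0Receptacle (E⁄K) v` and the same for `y_{m'}↑`» — bsd-idea-9 g7's LAB♭ conjunct),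
# and E′-label ⟹ receptacle-label, (B6) ⟹ receptacle-label (cell `bsd-stepL`, width seat `bsd-line-er5-p1-w3` g5; `--supports stmt-BirchSwinnertonDyer-19715 --as helper`)

WHY THIS FILE. The ideator's line card `Cruxes/EulerHalfNotRamNoInertSetAtFive/Lines/aux_norm_receptacle.md` (bsd-idea-9 g7, 13:12Z) proposes to
re-type the beyond-print conjunct of LAB ∕ item (ii) `ShimuraCarrierLabelsB6FromFive` in RECEPTACLE currency (LAB♭: the `hcop` ∕ `hrec` binders of the
generic cores, which its stubs S1–S3 would supply at a K-split carrier by «an auxiliary norm kills the component»). The companion file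
`…E0PrimeReceptacle` (p636748) re-threads the wrappers on Gross's E′-label (number-field places of `K[m]`); THIS FILE does the same one level
lower, on the receptacle-label itself (geometric local points over `K̄_v`), so that EITHER typing of (ii′) reaches 19715's SAV through the
producer-generic port targets (`…PortTargetsOfProducers` p636993, `…SavedOrderBoundOfProducers`):
* §1 `receptacleLabel_of_labelE0Prime` — E′-label at `q` ⟹ receptacle-label at `q` (`receptacle_of_labelE0Prime`); `receptacleLabel_of_labelB6_singleton` —
  `LabelB6 ι W N {q} ys` + irreducible `E[p]` ⟹ receptacle-label at `q` (`receptacle_of_labelB6`, `n' = #E(ℚ)_tors`). So LAB ⟹ LAB′ ⟹ LAB♭.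
* §1 `exists_uniform_exponent_of_carrierReceptacleLabels` — one exponent for all carriers outside `S` (finite product; `E0Receptacle` is a subgroup).
* §2 `familyReceptacle_of_receptacleLabel` — the family bricks' `hrec` for data `(d m).y = ys m` from the receptacle-label (bookkeeping `rw [hy]`).
* §3 `kolyvaginClass_familyData_mem_selmerLocalKer_of_labelsAt_of_tamagawa_of_receptacleLabels` (producer `hSel`) and
  `localization_kolyvaginClass_familyData_mem_stringentFamily_of_receptacleLabel_singleton` (producer `hstrq`).

HONEST FRAMING: THEOREMS ONLY (no def, no named fact, no `sorry`); labels are HYPOTHESES; nothing is asserted about any CM point; nothing closes;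
19715 OPEN; BSD proved for no curve (T7).
-- adapted from Summits/…/Theorems/ErratumRoadFiveEulerHalfNotRamE0PrimeReceptacle.lean §2–§4 (E′-label ↦ receptacle-label; same cores).
References (locators only): [cite: GrossLMS1991, §6, proof of Prop. 6.2 (1), p. 245] [cite: Jetchev2008, Prop. 4.6, Cor. 4.8, Prop. 4.9]
[cite: SilvermanAEC2009, VII.2 Prop. 2.1] [cite: MilneADT2006, Ch. I Prop. 3.8]. presearch: n/a (re-threading of tree theorems).
Axioms: `propext`, `Classical.choice`, `Quot.sound`.
-/

set_option autoImplicit false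
set_option linter.dupNamespace false -- `Summit.BirchSwinnertonDyer.BirchSwinnertonDyer` (summit = problem), tree-wide

noncomputable section

open scoped Classical NumberField Pointwise

namespace Summit.BirchSwinnertonDyer.BirchSwinnertonDyer.Theorems.ShimuraKolyvaginOfImage

open WeierstrassCurve IsDedekindDomain NumberField Field Literature.NumberTheory.EllipticCurves
  Literature.NumberTheory.EllipticCurves.ModularForms
  Literature.NumberTheory.GaloisRepresentations
  Summit.BirchSwinnertonDyer.Rank1Residual.X11b Literature.NumberTheory.Automorphic
  Summit.BirchSwinnertonDyer.Rank1Residual.JET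
  Literature.NumberTheory.EllipticCurves.ShimuraCMFamily

/-! ### §1 Into receptacle currency: from the E′-label, from (B6); one exponent for all carriers -/

/-- **E′-label at `q` ⟹ receptacle-label at `q`** (`K` imaginary quadratic, `q ∣ N` split in `K`): the conclusion of `receptacle_of_labelE0Prime`
repackaged as the receptacle-currency label «`∃ n'` coprime to `p` with `n' • (e (γ • ys m))_v ∈ E0Receptacle` at every guarded `m`, every embedding,
every `γ`, every `v ∋ q`, and the same for `ys m'` read in `K[m]`». [cite: GrossLMS1991, §6, proof of Prop. 6.2 (1), p. 245] -/
theorem receptacleLabel_of_labelE0Prime (W : WeierstrassCurve ℚ) [W.IsElliptic] [W.IsGloballyMinimal]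
    {K : Type} [Field K] [NumberField K] (hK : IsImaginaryQuadratic K) (ι : K →+* ℂ)
    (p : ℕ) [Fact p.Prime]
    {N : ℕ} (q : ℕ) [Fact q.Prime] (hqN : q ∣ N) (hq2 : ((Ideal.span {(q : ℤ)}).primesOver (𝓞 K)).ncard = 2)
    (ys : (m : ℕ) → (W.baseChange (ringClassField K ι m)).toAffine.Point)
    (hE0 : ∃ n' : ℕ, ¬ p ∣ n' ∧ ∀ m : ℕ, Squarefree m → (∀ r ∈ m.primeFactors, ¬ r ∣ N ∧ (Ideal.span {(r : 𝓞 K)}).IsPrime) →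
      ∀ [NumberField (ringClassField K ι m)] (w : HeightOneSpectrum (𝓞 (ringClassField K ι m))),
        ((q : ℕ) : 𝓞 (ringClassField K ι m)) ∈ w.asIdeal →
        (placeIntModel W (ringClassField K ι m) w).HasNonsingularReduction (K := ringClassField K ι m) (n' • ys m)) :
    ∃ n' : ℤ, IsCoprime (p : ℤ) n' ∧ ∀ m : ℕ, Squarefree m → (∀ r ∈ m.primeFactors, ¬ r ∣ N ∧ (Ideal.span {(r : 𝓞 K)}).IsPrime) →
        ∀ (e : ringClassField K ι m →ₐ[ℚ] AlgebraicClosure K)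
          (γ : ringClassField K ι m ≃ₐ[ℚ] ringClassField K ι m)
          (v : HeightOneSpectrum (𝓞 K)), ((q : ℕ) : 𝓞 K) ∈ v.asIdeal →
          n' • pointsMap (W.baseChange K) (v.adicCompletion K)
              (Affine.Point.map (W' := W) e (pointGalHom W (ringClassField K ι m) γ (ys m))) ∈
            E0Receptacle (W.baseChange K) v ∧
          ∀ (m' : ℕ), Squarefree m' → (∀ r ∈ m'.primeFactors, ¬ r ∣ N ∧ (Ideal.span {(r : 𝓞 K)}).IsPrime) →
            ∀ (hle : ringClassField K ι m' ≤ ringClassField K ι m),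
            n' • pointsMap (W.baseChange K) (v.adicCompletion K)
                (Affine.Point.map (W' := W) e (pointGalHom W (ringClassField K ι m) γ
                  (WeierstrassCurve.Affine.Point.map (W' := W)
                    ((RingClassField.inclusion ι hle).restrictScalars ℚ) (ys m')))) ∈
              E0Receptacle (W.baseChange K) v := by
  haveI : ∀ j : ℕ, NumberField (ringClassField K ι j) := numberField_ringClassField K hK ι
  obtain ⟨n', hpn', hE0'⟩ := hE0
  obtain ⟨hcop, hrec⟩ := receptacle_of_labelE0Prime W hK ι p q hqN hq2 ys hpn' (fun m hm hg w hw ↦ hE0' m hm hg w hw)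
  exact ⟨(n' : ℤ), hcop, hrec⟩

/-- **(B6) at `q` ⟹ receptacle-label at `q`**, for irreducible `E[p]` (`receptacle_of_labelB6`, `n' = #E(ℚ)_tors`): with §1's first theorem,
LAB ⟹ LAB′ ⟹ LAB♭ — every currency of the identity-component input is WEAKER than v13's LAB. [cite: GrossLMS1991, §6, proof of Prop. 6.2 (1), p. 245] -/
theorem receptacleLabel_of_labelB6_singleton (W : WeierstrassCurve ℚ) [W.IsElliptic] [W.IsGloballyMinimal]
    {K : Type} [Field K] [NumberField K] (hK : IsImaginaryQuadratic K) (ι : K →+* ℂ)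
    (p : ℕ) [Fact p.Prime] (hirr : W.HasIrreducibleModPGaloisRep p)
    {N : ℕ} (q : ℕ) [Fact q.Prime] (hqN : q ∣ N) (hq2 : ((Ideal.span {(q : ℤ)}).primesOver (𝓞 K)).ncard = 2)
    (ys : (m : ℕ) → (W.baseChange (ringClassField K ι m)).toAffine.Point) (hB6 : LabelB6 ι W N {q} ys) :
    ∃ n' : ℤ, IsCoprime (p : ℤ) n' ∧ ∀ m : ℕ, Squarefree m → (∀ r ∈ m.primeFactors, ¬ r ∣ N ∧ (Ideal.span {(r : 𝓞 K)}).IsPrime) →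
        ∀ (e : ringClassField K ι m →ₐ[ℚ] AlgebraicClosure K)
          (γ : ringClassField K ι m ≃ₐ[ℚ] ringClassField K ι m)
          (v : HeightOneSpectrum (𝓞 K)), ((q : ℕ) : 𝓞 K) ∈ v.asIdeal →
          n' • pointsMap (W.baseChange K) (v.adicCompletion K)
              (Affine.Point.map (W' := W) e (pointGalHom W (ringClassField K ι m) γ (ys m))) ∈
            E0Receptacle (W.baseChange K) v ∧
          ∀ (m' : ℕ), Squarefree m' → (∀ r ∈ m'.primeFactors, ¬ r ∣ N ∧ (Ideal.span {(r : 𝓞 K)}).IsPrime) →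
            ∀ (hle : ringClassField K ι m' ≤ ringClassField K ι m),
            n' • pointsMap (W.baseChange K) (v.adicCompletion K)
                (Affine.Point.map (W' := W) e (pointGalHom W (ringClassField K ι m) γ
                  (WeierstrassCurve.Affine.Point.map (W' := W)
                    ((RingClassField.inclusion ι hle).restrictScalars ℚ) (ys m')))) ∈
              E0Receptacle (W.baseChange K) v := by
  haveI : ∀ j : ℕ, NumberField (ringClassField K ι j) := numberField_ringClassField K hK ι
  obtain ⟨hcop, hrec⟩ := receptacle_of_labelB6 W hK ι p hirr q hqN hq2 ys (hB6.at' (Finset.mem_singleton_self q))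
  exact ⟨(W.torsionOrder : ℤ), hcop, hrec⟩

/-- **One exponent for all carriers outside `S`, receptacle currency.** From per-carrier receptacle-labels to a SINGLE `n'` coprime to `p` serving
every carrier (the product over the prime factors of `N`; `E0Receptacle` is a subgroup). Bookkeeping for the Kummer producer of §3.
[cite: GrossLMS1991, §6, proof of Prop. 6.2 (1), p. 245] [cite: SilvermanAEC2009, VII.2 Prop. 2.1] -/
theorem exists_uniform_exponent_of_carrierReceptacleLabels (W : WeierstrassCurve ℚ) [W.IsElliptic] [W.IsGloballyMinimal]
    {K : Type} [Field K] [NumberField K] (ι : K →+* ℂ) (p : ℕ) [Fact p.Prime]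
    {N : ℕ} [NeZero N] (S : Finset ℕ) (ys : (m : ℕ) → (W.baseChange (ringClassField K ι m)).toAffine.Point)
    (hRecT : ∀ (q : ℕ) [Fact q.Prime], q ∣ N → q ∉ S → p ∣ (W.baseChange ℚ_[q]).localTamagawaNumber ℤ_[q] →
      ∃ n' : ℤ, IsCoprime (p : ℤ) n' ∧ ∀ m : ℕ, Squarefree m → (∀ r ∈ m.primeFactors, ¬ r ∣ N ∧ (Ideal.span {(r : 𝓞 K)}).IsPrime) →
        ∀ (e : ringClassField K ι m →ₐ[ℚ] AlgebraicClosure K)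
          (γ : ringClassField K ι m ≃ₐ[ℚ] ringClassField K ι m)
          (v : HeightOneSpectrum (𝓞 K)), ((q : ℕ) : 𝓞 K) ∈ v.asIdeal →
          n' • pointsMap (W.baseChange K) (v.adicCompletion K)
              (Affine.Point.map (W' := W) e (pointGalHom W (ringClassField K ι m) γ (ys m))) ∈
            E0Receptacle (W.baseChange K) v ∧
          ∀ (m' : ℕ), Squarefree m' → (∀ r ∈ m'.primeFactors, ¬ r ∣ N ∧ (Ideal.span {(r : 𝓞 K)}).IsPrime) →
            ∀ (hle : ringClassField K ι m' ≤ ringClassField K ι m),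
            n' • pointsMap (W.baseChange K) (v.adicCompletion K)
                (Affine.Point.map (W' := W) e (pointGalHom W (ringClassField K ι m) γ
                  (WeierstrassCurve.Affine.Point.map (W' := W)
                    ((RingClassField.inclusion ι hle).restrictScalars ℚ) (ys m')))) ∈
              E0Receptacle (W.baseChange K) v) :
    ∃ n' : ℤ, IsCoprime (p : ℤ) n' ∧ ∀ (q : ℕ) [Fact q.Prime], q ∣ N → q ∉ S →
      p ∣ (W.baseChange ℚ_[q]).localTamagawaNumber ℤ_[q] →
      ∀ m : ℕ, Squarefree m → (∀ r ∈ m.primeFactors, ¬ r ∣ N ∧ (Ideal.span {(r : 𝓞 K)}).IsPrime) →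
        ∀ (e : ringClassField K ι m →ₐ[ℚ] AlgebraicClosure K)
          (γ : ringClassField K ι m ≃ₐ[ℚ] ringClassField K ι m)
          (v : HeightOneSpectrum (𝓞 K)), ((q : ℕ) : 𝓞 K) ∈ v.asIdeal →
          n' • pointsMap (W.baseChange K) (v.adicCompletion K)
              (Affine.Point.map (W' := W) e (pointGalHom W (ringClassField K ι m) γ (ys m))) ∈
            E0Receptacle (W.baseChange K) v ∧
          ∀ (m' : ℕ), Squarefree m' → (∀ r ∈ m'.primeFactors, ¬ r ∣ N ∧ (Ideal.span {(r : 𝓞 K)}).IsPrime) →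
            ∀ (hle : ringClassField K ι m' ≤ ringClassField K ι m),
            n' • pointsMap (W.baseChange K) (v.adicCompletion K)
                (Affine.Point.map (W' := W) e (pointGalHom W (ringClassField K ι m) γ
                  (WeierstrassCurve.Affine.Point.map (W' := W)
                    ((RingClassField.inclusion ι hle).restrictScalars ℚ) (ys m')))) ∈
              E0Receptacle (W.baseChange K) v := by
  have hp : p.Prime := Fact.out
  have hN0 : N ≠ 0 := NeZero.ne N
  -- per-prime exponent, `1` off the carriers
  have hex : ∀ q ∈ N.primeFactors, ∃ nq : ℤ, IsCoprime (p : ℤ) nq ∧ ∀ (hq : Fact q.Prime), q ∉ S →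
      p ∣ (W.baseChange ℚ_[q]).localTamagawaNumber ℤ_[q] →
      ∀ m : ℕ, Squarefree m → (∀ r ∈ m.primeFactors, ¬ r ∣ N ∧ (Ideal.span {(r : 𝓞 K)}).IsPrime) →
        ∀ (e : ringClassField K ι m →ₐ[ℚ] AlgebraicClosure K)
          (γ : ringClassField K ι m ≃ₐ[ℚ] ringClassField K ι m)
          (v : HeightOneSpectrum (𝓞 K)), ((q : ℕ) : 𝓞 K) ∈ v.asIdeal →
          nq • pointsMap (W.baseChange K) (v.adicCompletion K)
              (Affine.Point.map (W' := W) e (pointGalHom W (ringClassField K ι m) γ (ys m))) ∈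
            E0Receptacle (W.baseChange K) v ∧
          ∀ (m' : ℕ), Squarefree m' → (∀ r ∈ m'.primeFactors, ¬ r ∣ N ∧ (Ideal.span {(r : 𝓞 K)}).IsPrime) →
            ∀ (hle : ringClassField K ι m' ≤ ringClassField K ι m),
            nq • pointsMap (W.baseChange K) (v.adicCompletion K)
                (Affine.Point.map (W' := W) e (pointGalHom W (ringClassField K ι m) γ
                  (WeierstrassCurve.Affine.Point.map (W' := W)
                    ((RingClassField.inclusion ι hle).restrictScalars ℚ) (ys m')))) ∈
              E0Receptacle (W.baseChange K) v := by
    intro q hq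
    haveI hqF : Fact q.Prime := ⟨Nat.prime_of_mem_primeFactors hq⟩
    by_cases hc : q ∉ S ∧ p ∣ (W.baseChange ℚ_[q]).localTamagawaNumber ℤ_[q]
    · obtain ⟨nq, hpnq, hnq⟩ := hRecT q (Nat.dvd_of_mem_primeFactors hq) hc.1 hc.2
      exact ⟨nq, hpnq, fun _ _ _ ↦ hnq⟩
    · exact ⟨1, isCoprime_one_right, fun _ hqS hcq ↦ (hc ⟨hqS, hcq⟩).elim⟩
  choose! nq hpnq hnq using hex
  refine ⟨∏ q ∈ N.primeFactors, nq q, IsCoprime.prod_right fun q hq ↦ hpnq q hq, fun q _ hqN hqS hcq m hm hg e γ v hqv ↦ ?_⟩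
  have hq : q ∈ N.primeFactors := Nat.mem_primeFactors.mpr ⟨Fact.out, hqN, hN0⟩
  obtain ⟨k, hk⟩ := Finset.dvd_prod_of_mem nq hq
  obtain ⟨h1, h2⟩ := hnq q hq _ hqS hcq m hm hg e γ v hqv
  refine ⟨?_, fun m' hm' hg' hle ↦ ?_⟩
  · rw [hk, mul_zsmul']
    exact AddSubgroup.zsmul_mem _ h1 k
  · rw [hk, mul_zsmul']
    exact AddSubgroup.zsmul_mem _ (h2 m' hm' hg' hle) k

end Summit.BirchSwinnertonDyer.BirchSwinnertonDyer.Theorems.ShimuraKolyvaginOfImage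

/-! ### §2 The family receptacle from the receptacle-label -/

namespace Summit.BirchSwinnertonDyer.BirchSwinnertonDyer.Theorems.ShimuraWalk

open WeierstrassCurve Field NumberField IsDedekindDomain Finset
  Literature.NumberTheory.EllipticCurves Literature.NumberTheory.GaloisRepresentations
  Literature.NumberTheory.EllipticCurves.KolyvaginCocycle
  Literature.NumberTheory.EllipticCurves.RingClassField
  Literature.NumberTheory.EllipticCurves.ModularForms
  Summit.BirchSwinnertonDyer.Rank1Residual.X11b
  Summit.BirchSwinnertonDyer.Rank1Residual.JET
  Summit.BirchSwinnertonDyer.BirchSwinnertonDyer.Theorems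
  Literature.NumberTheory.EllipticCurves.ShimuraCMFamily Literature.NumberTheory.Automorphic

variable {K : Type} [Field K] [NumberField K] {W : WeierstrassCurve ℚ} {ι : K →+* ℂ}

/-- **The E⁰-receptacle over a split bad prime in the shape the family bricks consume, from the receptacle-label** with exponent `n'`: at every
`m ∣ n`, every `γ`, every `v ∋ q`, `n' • ((d m).toGeomPoints (γ • y(m)))_v ∈ E⁰(K̄_v)` and the same for `y(m∕ℓ)↑`, for a family of data with
`(d m).y = ys m` (the datum's own embedding `(d m).emb`; bookkeeping `rw [hy]`). [cite: GrossLMS1991, §6 proof of Prop. 6.2 (1), p. 245] -/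
theorem familyReceptacle_of_receptacleLabel {N : ℕ} [W.IsElliptic] [W.IsGloballyMinimal] (ι : K →+* ℂ)
    {n : ℕ} (hn : Squarefree n) (hguard : ∀ q ∈ n.primeFactors, ¬ q ∣ N ∧ (Ideal.span {(q : 𝓞 K)}).IsPrime)
    (ys : (m : ℕ) → (W.baseChange (ringClassField K ι m)).toAffine.Point)
    {q : ℕ} {n' : ℤ}
    (hRec : ∀ m : ℕ, Squarefree m → (∀ r ∈ m.primeFactors, ¬ r ∣ N ∧ (Ideal.span {(r : 𝓞 K)}).IsPrime) →
      ∀ (e : ringClassField K ι m →ₐ[ℚ] AlgebraicClosure K)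
        (γ : ringClassField K ι m ≃ₐ[ℚ] ringClassField K ι m)
        (v : HeightOneSpectrum (𝓞 K)), ((q : ℕ) : 𝓞 K) ∈ v.asIdeal →
        n' • pointsMap (W.baseChange K) (v.adicCompletion K)
            (Affine.Point.map (W' := W) e (pointGalHom W (ringClassField K ι m) γ (ys m))) ∈
          E0Receptacle (W.baseChange K) v ∧
        ∀ (m' : ℕ), Squarefree m' → (∀ r ∈ m'.primeFactors, ¬ r ∣ N ∧ (Ideal.span {(r : 𝓞 K)}).IsPrime) →
          ∀ (hle : ringClassField K ι m' ≤ ringClassField K ι m),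
          n' • pointsMap (W.baseChange K) (v.adicCompletion K)
              (Affine.Point.map (W' := W) e (pointGalHom W (ringClassField K ι m) γ
                (WeierstrassCurve.Affine.Point.map (W' := W)
                  ((RingClassField.inclusion ι hle).restrictScalars ℚ) (ys m')))) ∈
            E0Receptacle (W.baseChange K) v)
    (d : (m : ℕ) → m ∣ n → KolyvaginFamilyData W K ι m) (hy : ∀ (m : ℕ) (hm : m ∣ n), (d m hm).y = ys m) :
    ∀ (m : ℕ) (hm : m ∣ n) (γ : ringClassField K ι m ≃ₐ[ℚ] ringClassField K ι m) (v : HeightOneSpectrum (𝓞 K)),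
      ((q : ℕ) : 𝓞 K) ∈ v.asIdeal →
        n' • pointsMap (W.baseChange K) (v.adicCompletion K)
            ((d m hm).toGeomPoints (pointGalHom W (ringClassField K ι m) γ (d m hm).y)) ∈
          E0Receptacle (W.baseChange K) v ∧
        ∀ (ℓ : ℕ) (hℓ : ℓ ∈ m.primeFactors)
          (hle : ringClassField K ι (m / ℓ) ≤ ringClassField K ι m),
          n' • pointsMap (W.baseChange K) (v.adicCompletion K)
              ((d m hm).toGeomPoints (pointGalHom W (ringClassField K ι m) γ
                (WeierstrassCurve.Affine.Point.map (W' := W)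
                  ((RingClassField.inclusion ι hle).restrictScalars ℚ)
                  (d (m / ℓ) ((Nat.div_dvd_of_dvd (Nat.dvd_of_mem_primeFactors hℓ)).trans hm)).y))) ∈
            E0Receptacle (W.baseChange K) v := by
  have hn0 : n ≠ 0 := hn.ne_zero
  have hg : ∀ (m : ℕ), m ∣ n → ∀ q ∈ m.primeFactors, ¬ q ∣ N ∧ (Ideal.span {(q : 𝓞 K)}).IsPrime :=
    fun m hm q hq ↦ hguard q (Nat.primeFactors_mono hm hn0 hq)
  intro m hm γ v hqv
  obtain ⟨h1, h2⟩ := hRec m (hn.squarefree_of_dvd hm) (hg m hm) (d m hm).emb.toRatAlgHom γ v hqv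
  refine ⟨?_, fun ℓ hℓ hle ↦ ?_⟩
  · rw [hy m hm]
    exact h1
  · have hm' : m / ℓ ∣ n := (Nat.div_dvd_of_dvd (Nat.dvd_of_mem_primeFactors hℓ)).trans hm
    rw [hy (m / ℓ) hm']
    exact h2 (m / ℓ) (hn.squarefree_of_dvd hm') (hg (m / ℓ) hm') hle

/-! ### §3 The two single-datum producers from the receptacle-labels at the carriers -/

set_option maxHeartbeats 800000 in
/-- **The producer `hSel`** (Gross 6.2 (1): `c_M(d) ∈ Sel_𝔳` at every finite `𝔳 ∤ n`) for EVERY datum `d` with `d.y = ys n` on a Shimura frame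
`(W, N, K, S)` carrying `LabelsAt`, the RECEPTACLE-LABELS AT THE CARRIER PRIMES OUTSIDE `S` (`hRecT`), the displayed Milne I.3.8 hypothesis `hM38`,
admissible `E(K[m])` — the generic Kummer core `kolyvaginClass_familyData_mem_selmerLocalKer_of_tamagawa` fed with one exponent for all carriers (§1) and
§2's family receptacle. [cite: GrossLMS1991, §6 Prop. 6.2 (1), p. 245] [cite: Jetchev2008, Prop. 4.6, Cor. 4.8] [cite: MilneADT2006, Ch. I Prop. 3.8] -/
theorem kolyvaginClass_familyData_mem_selmerLocalKer_of_labelsAt_of_tamagawa_of_receptacleLabels {N : ℕ} [NeZero N] [W.IsElliptic]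
    [W.IsGloballyMinimal]
    (hK : IsImaginaryQuadratic K) (ι : K →+* ℂ) (hN : W.conductorNorm ℤ = N) {p : ℕ} [Fact p.Prime]
    (Dt : ModularParametrizationData W N)
    {S : Finset ℕ}
    (hin : ∀ ℓ ∈ S, ℓ.Prime ∧ ℓ ∣ N ∧ ¬ ℓ ^ 2 ∣ N ∧
      ((Ideal.span {(ℓ : ℤ)}).primesOver (𝓞 K)).ncard = 1 ∧ ¬ (ℓ : ℤ) ∣ NumberField.discr K)
    (hsp : ∀ ℓ : ℕ, ℓ.Prime → ℓ ∣ N → ℓ ∉ S → ((Ideal.span {(ℓ : ℤ)}).primesOver (𝓞 K)).ncard = 2)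
    (ys : (m : ℕ) → (W.baseChange (ringClassField K ι m)).toAffine.Point)
    {yK : (W.baseChange K).toAffine.Point} {ε : ℤ} (hL : LabelsAt W N K ι yK ys ε)
    (hRecT : ∀ (q : ℕ) [Fact q.Prime], q ∣ N → q ∉ S → p ∣ (W.baseChange ℚ_[q]).localTamagawaNumber ℤ_[q] →
      ∃ n' : ℤ, IsCoprime (p : ℤ) n' ∧ ∀ m : ℕ, Squarefree m → (∀ r ∈ m.primeFactors, ¬ r ∣ N ∧ (Ideal.span {(r : 𝓞 K)}).IsPrime) →
        ∀ (e : ringClassField K ι m →ₐ[ℚ] AlgebraicClosure K)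
          (γ : ringClassField K ι m ≃ₐ[ℚ] ringClassField K ι m)
          (v : HeightOneSpectrum (𝓞 K)), ((q : ℕ) : 𝓞 K) ∈ v.asIdeal →
          n' • pointsMap (W.baseChange K) (v.adicCompletion K)
              (Affine.Point.map (W' := W) e (pointGalHom W (ringClassField K ι m) γ (ys m))) ∈
            E0Receptacle (W.baseChange K) v ∧
          ∀ (m' : ℕ), Squarefree m' → (∀ r ∈ m'.primeFactors, ¬ r ∣ N ∧ (Ideal.span {(r : 𝓞 K)}).IsPrime) →
            ∀ (hle : ringClassField K ι m' ≤ ringClassField K ι m),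
            n' • pointsMap (W.baseChange K) (v.adicCompletion K)
                (Affine.Point.map (W' := W) e (pointGalHom W (ringClassField K ι m) γ
                  (WeierstrassCurve.Affine.Point.map (W' := W)
                    ((RingClassField.inclusion ι hle).restrictScalars ℚ) (ys m')))) ∈
              E0Receptacle (W.baseChange K) v)
    (hM38 : ∀ (v : HeightOneSpectrum (𝓞 K)) {𝔐 : Ideal (v.localAbsIntegers)}, 𝔐 ∈ v.localPrimesAbove →
      ∀ f : contOneCocycles (discreteTopRep (absoluteGaloisGroup (v.adicCompletion K))
          (localPoints (W.baseChange K) (v.adicCompletion K))),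
        (∀ σ ∈ 𝔐.inertia (absoluteGaloisGroup (v.adicCompletion K)), f.1 σ = 0) →
        (((W.baseChange K).baseChange (v.adicCompletion K)).localTamagawaNumber (v.adicCompletionIntegers K) : ℤ) •
          oneCocycleClass (discreteTopRep (absoluteGaloisGroup (v.adicCompletion K))
            (localPoints (W.baseChange K) (v.adicCompletion K))) f = 0)
    (hA : ∀ (m : ℕ) (dm : KolyvaginFamilyData W K ι m), dm.y = ys m → Squarefree m →
      (∀ q ∈ m.primeFactors, IsKolyvaginPrime N W K p q) →
      ∀ j : ℕ, IsAdmissible (absoluteGaloisGroup K) dm.pointsSubgroup ((p ^ j : ℕ) : ℤ))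
    (M n : ℕ) (d : KolyvaginFamilyData W K ι n) (hM : 1 ≤ M) (hdy : d.y = ys n) (hn : Squarefree n)
    (hKol : ∀ q ∈ n.primeFactors, IsKolyvaginPrime N W K p q ∧ FrobEqFrobInfty W K (p ^ M) q)
    (𝔳 : HeightOneSpectrum (𝓞 K)) (h𝔳 : (n : 𝓞 K) ∉ 𝔳.asIdeal) :
    d.kolyvaginClass (Fact.out : p.Prime) M ∈ selmerLocalKer (W.baseChange K) (𝔳.adicCompletion K) ((p ^ M : ℕ) : ℤ) := by
  have hp : p.Prime := Fact.out
  have hn0 : n ≠ 0 := hn.ne_zero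
  have hguard : ∀ q ∈ n.primeFactors, ¬ q ∣ N ∧ (Ideal.span {(q : 𝓞 K)}).IsPrime :=
    fun q hq ↦ ⟨(hKol q hq).1.2.1, (hKol q hq).1.2.2.2.2.1⟩
  obtain ⟨D, hDd, hDy⟩ := exists_familyData_extension (W := W) hK ι hn (fun q hq ↦ (hguard q hq).2) ys d hdy
  subst hDd
  obtain ⟨hB4d, -, -⟩ := familyLabels_of_labelsAt (W := W) hn hguard ys hL D hDy
  -- ONE exponent for every carrier outside `S`
  obtain ⟨n', hcop1, hRec⟩ := ShimuraKolyvaginOfImage.exists_uniform_exponent_of_carrierReceptacleLabels W ι p S ys hRecT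
  have hcop : IsCoprime ((p ^ M : ℕ) : ℤ) n' := by
    rw [Nat.cast_pow]; exact hcop1.pow_left
  have hA' : ∀ (m : ℕ) (hm : m ∣ n), IsAdmissible (absoluteGaloisGroup K) (D m hm).pointsSubgroup ((p ^ M : ℕ) : ℤ) :=
    fun m hm ↦ hA m (D m hm) (hDy m hm) (hn.squarefree_of_dvd hm)
      (fun q hq ↦ (hKol q (Nat.primeFactors_mono hm hn0 hq)).1) M
  have hrec : ∀ (q : ℕ), q.Prime → q ∣ N → q ∉ S → ∀ (m : ℕ) (hm : m ∣ n)
      (γ : ringClassField K ι m ≃ₐ[ℚ] ringClassField K ι m) (v : HeightOneSpectrum (𝓞 K)),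
      ((q : ℕ) : 𝓞 K) ∈ v.asIdeal →
      p ∣ ((W.baseChange K).baseChange (v.adicCompletion K)).localTamagawaNumber (v.adicCompletionIntegers K) →
        n' • pointsMap (W.baseChange K) (v.adicCompletion K)
            ((D m hm).toGeomPoints (pointGalHom W (ringClassField K ι m) γ (D m hm).y)) ∈
          E0Receptacle (W.baseChange K) v ∧
        ∀ (ℓ : ℕ) (hℓ : ℓ ∈ m.primeFactors)
          (hle : ringClassField K ι (m / ℓ) ≤ ringClassField K ι m),
          n' • pointsMap (W.baseChange K) (v.adicCompletion K)
              ((D m hm).toGeomPoints (pointGalHom W (ringClassField K ι m) γ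
                (WeierstrassCurve.Affine.Point.map (W' := W)
                  ((RingClassField.inclusion ι hle).restrictScalars ℚ)
                  (D (m / ℓ) ((Nat.div_dvd_of_dvd (Nat.dvd_of_mem_primeFactors hℓ)).trans hm)).y))) ∈
            E0Receptacle (W.baseChange K) v := by
    intro q hqp hqN hqS m hm γ v hqv hcv
    haveI : Fact q.Prime := ⟨hqp⟩
    have hq2 := hsp q hqp hqN hqS
    have hcq : p ∣ (W.baseChange ℚ_[q]).localTamagawaNumber ℤ_[q] :=
      dvd_localTamagawaNumber_padic_of_dvd_of_ncard_eq_two (W := W) hK q hq2 hqN v hqv hcv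
    exact familyReceptacle_of_receptacleLabel (W := W) ι hn hguard ys
      (fun m hm hg e γ v hqv ↦ hRec q hqN hqS hcq m hm hg e γ v hqv) D hDy m hm γ v hqv
  exact kolyvaginClass_familyData_mem_selmerLocalKer_of_tamagawa hK ι hN hp hM Dt hM38 hin hn hKol D hB4d hcop hrec
    hA' n dvd_rfl 𝔳 h𝔳

set_option maxHeartbeats 800000 in
/-- **The producer `hstrq`** (Jetchev Prop. 4.9 at a bad place `v` over the exempted split prime `q ∉ S`, `q ∣ N`) for EVERY datum `d` with `d.y = ys n`
on a Shimura frame carrying `LabelsAt` and the RECEPTACLE-LABEL at that prime (exponent `n'` coprime to `p`), admissible `E(K[m])` — the generic core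
`localization_kolyvaginClass_familyData_mem_stringentFamily` fed with §2's family receptacle. [cite: Jetchev2008, Prop. 4.9, Cor. 4.8]
[cite: GrossLMS1991, §6, proof of Prop. 6.2 (1), p. 245] -/
theorem localization_kolyvaginClass_familyData_mem_stringentFamily_of_receptacleLabel_singleton {N : ℕ} [NeZero N]
    [W.IsElliptic] [W.IsGloballyMinimal]
    (hK : IsImaginaryQuadratic K) (ι : K →+* ℂ) {p : ℕ} [Fact p.Prime]
    (Dt : ModularParametrizationData W N)
    {S : Finset ℕ}
    (hsp : ∀ ℓ : ℕ, ℓ.Prime → ℓ ∣ N → ℓ ∉ S → ((Ideal.span {(ℓ : ℤ)}).primesOver (𝓞 K)).ncard = 2)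
    (ys : (m : ℕ) → (W.baseChange (ringClassField K ι m)).toAffine.Point)
    {yK : (W.baseChange K).toAffine.Point} {ε : ℤ} (hL : LabelsAt W N K ι yK ys ε)
    (q : ℕ) [Fact q.Prime] (hqN : q ∣ N) (hqS : q ∉ S) {n' : ℤ} (hcop1 : IsCoprime (p : ℤ) n')
    (hRecq : ∀ m : ℕ, Squarefree m → (∀ r ∈ m.primeFactors, ¬ r ∣ N ∧ (Ideal.span {(r : 𝓞 K)}).IsPrime) →
      ∀ (e : ringClassField K ι m →ₐ[ℚ] AlgebraicClosure K)
        (γ : ringClassField K ι m ≃ₐ[ℚ] ringClassField K ι m)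
        (v : HeightOneSpectrum (𝓞 K)), ((q : ℕ) : 𝓞 K) ∈ v.asIdeal →
        n' • pointsMap (W.baseChange K) (v.adicCompletion K)
            (Affine.Point.map (W' := W) e (pointGalHom W (ringClassField K ι m) γ (ys m))) ∈
          E0Receptacle (W.baseChange K) v ∧
        ∀ (m' : ℕ), Squarefree m' → (∀ r ∈ m'.primeFactors, ¬ r ∣ N ∧ (Ideal.span {(r : 𝓞 K)}).IsPrime) →
          ∀ (hle : ringClassField K ι m' ≤ ringClassField K ι m),
          n' • pointsMap (W.baseChange K) (v.adicCompletion K)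
              (Affine.Point.map (W' := W) e (pointGalHom W (ringClassField K ι m) γ
                (WeierstrassCurve.Affine.Point.map (W' := W)
                  ((RingClassField.inclusion ι hle).restrictScalars ℚ) (ys m')))) ∈
            E0Receptacle (W.baseChange K) v)
    (hA : ∀ (m : ℕ) (dm : KolyvaginFamilyData W K ι m), dm.y = ys m → Squarefree m →
      (∀ q ∈ m.primeFactors, IsKolyvaginPrime N W K p q) →
      ∀ j : ℕ, IsAdmissible (absoluteGaloisGroup K) dm.pointsSubgroup ((p ^ j : ℕ) : ℤ))
    (k : ℕ) (hn' : ((p ^ k : ℕ) : ℤ) ≠ 0) (n : ℕ) (d : KolyvaginFamilyData W K ι n) (hk : 1 ≤ k) (hdy : d.y = ys n)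
    (hn : Squarefree n)
    (hKol : ∀ q' ∈ n.primeFactors, IsKolyvaginPrime N W K p q' ∧ FrobEqFrobInfty W K (p ^ k) q')
    (v : HeightOneSpectrum (𝓞 K)) (hqv : ((q : ℕ) : 𝓞 K) ∈ v.asIdeal) (hbad : ¬ (W.baseChange K).HasGoodReductionAt v) :
    galoisCohomology.localization ((W.baseChange K).torsionGaloisModule ((p ^ k : ℕ) : ℤ)) (Sum.inr v) 1
        (d.kolyvaginClass (Fact.out : p.Prime) k) ∈ stringentFamily W K hn' (Sum.inr v) := by
  have hp : p.Prime := Fact.out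
  have hq : q.Prime := Fact.out
  have hn0 : n ≠ 0 := hn.ne_zero
  have hguard : ∀ q' ∈ n.primeFactors, ¬ q' ∣ N ∧ (Ideal.span {(q' : 𝓞 K)}).IsPrime :=
    fun q' hq' ↦ ⟨(hKol q' hq').1.2.1, (hKol q' hq').1.2.2.2.2.1⟩
  -- `v ∌ n`: the primes of `n` are prime to `N`, `q ∣ N`
  have hnv : (n : 𝓞 K) ∉ v.asIdeal :=
    natCast_not_mem_asIdeal_of_prime_mem v hq hqv hn0 fun ℓ hℓ hℓq ↦ (hguard ℓ hℓ).1 (hℓq ▸ hqN)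
  obtain ⟨D, hDd, hDy⟩ := exists_familyData_extension (W := W) hK ι hn (fun q' hq' ↦ (hguard q' hq').2) ys d hdy
  subst hDd
  obtain ⟨hB4d, -, -⟩ := familyLabels_of_labelsAt (W := W) hn hguard ys hL D hDy
  have hq2 := hsp q hq hqN hqS
  have hrecQ := familyReceptacle_of_receptacleLabel (W := W) ι hn hguard ys hRecq D hDy
  have hcop : IsCoprime ((p ^ k : ℕ) : ℤ) n' := by
    rw [Nat.cast_pow]; exact hcop1.pow_left
  have hA' : ∀ (m : ℕ) (hm : m ∣ n), IsAdmissible (absoluteGaloisGroup K) (D m hm).pointsSubgroup ((p ^ k : ℕ) : ℤ) :=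
    fun m hm ↦ hA m (D m hm) (hDy m hm) (hn.squarefree_of_dvd hm)
      (fun q' hq' ↦ (hKol q' (Nat.primeFactors_mono hm hn0 hq')).1) k
  exact localization_kolyvaginClass_familyData_mem_stringentFamily hK ι hp hk hn' Dt hn hKol D hB4d hA' dvd_rfl q hqN hq2
    v hqv hnv hbad hcop (fun γ ↦ hrecQ n dvd_rfl γ v hqv)

end Summit.BirchSwinnertonDyer.BirchSwinnertonDyer.Theorems.ShimuraWalk

end
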